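import Summits.NavierStokesRegularity.NavierStokesRegularity.Theorems.ScenarioCensusHullMeter
import Summits.NavierStokesRegularity.NavierStokesRegularity.Theorems.TypeIQuarterGateScarEnvelopeTypeINearOneRateDss
import HarnessLib

/-!
# HULL METER port, part 2/4: §D the CONVERGENCE-MODE × SCALE-ARITHMETIC dial (zooms converging along an `F`-stable scale set kill the element); §E the ZOOM-DEFECT SPECTRUM (universal gap);
# §F the CARDINALITY dial (a countable past-hull forces triviality)

Re-homed for the scenario census (typer seat ns-census-typer-1 g10; the cells A2huN / A2huS / A2huR / A2huF / A2huC / A2huD / A2huDf / A2hu2c are MEMBERS OF RECORD «DECIDED IN KERNEL IN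
FILES» of row A2 (item 76: REV 1 critic PASS, REV 3 idea-crit-3 g10 ROW WORDS BY KEY 11:55:14Z; ref PRE-CHECK ✓ §18.33; lead label LBL76r3), A2huL / A2huDL OPEN ≡ D7
(`CoarsePastLiouville`); this port makes the decided cells TREE-decided): VERBATIM PORT of ns-idea-2 LINE g17-1 «hull-meter» REV 3,
`pub/ideators/ns-idea-2/lines/hull-meter/line-hull-meter.rev3.lean` sha16 ab921f346883452d (1125 l., lean check rc 0, 0 sorry), split for the 400-line rule into
`ScenarioCensusHullMeter` (§A–§C) → `…HullMeterDials` (§D–§F) → `…HullMeterRows` (§G, §H, §G′) → `…HullMeterTwoCentre` (§G″, §I + census KEYS).  Lean text VERBATIM in namespace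
`…Theorems.ScenarioCensus.HullMeter` (the line's `…Lines.HullMeter` re-homed); port edits: the line's `local notation "E3"` is spelled as the reducible `abbrev E3` of every census
file; the line's import of the crux workfile `Cruxes/ScarEnvelopeTypeI/Lines/axis_activity` is replaced by its landed Theorems home
`Theorems.TypeIQuarterGateScarEnvelopeTypeINearOneRateDss` (same namespace `…Cruxes.ScarEnvelopeTypeI.AxisActivity`, same names `NearOneRateDss` / `nearOneRateDss_proof` /
`isDiscretelySelfSimilar_pow`); `set_option linter.unusedVariables false` dropped (binders the linter names are `_`-prefixed); `@[conjecture]` on the OPEN statements `CoarsePastLiouville`,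
`CoarseGapLaw`, `Row_A2huL`, `Row_A2huDL` (≡ census D7, OPEN); one-line docstrings added where missing (gate lint).  Statements untouched.

No census VALUE is moved here (row A2 stays OPEN-WITH-LINE; the members become TREE-decided by name); D7 / (L′) are NOT proved; no summit statement is proved by this file.
-/

-- the summit and its single problem share the name `NavierStokesRegularity` (D-0017 nested layout)
set_option linter.dupNamespace false

noncomputable section

open Set Function Filter Metric
open scoped Topology
open Literature.Analysis Literature.Analysis.FluidPDE
open Summit.NavierStokesRegularity.NavierStokesRegularity.Theorems
open Summit.NavierStokesRegularity.NavierStokesRegularity.Theorems.ScenarioCensus.ScrewBlowdown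
open Summit.NavierStokesRegularity.NavierStokesRegularity.Theorems.ScenarioCensus.ScalingSpectrum
open Summit.NavierStokesRegularity.NavierStokesRegularity.Theorems.PoloidalWindowDoorPoloidalWindowRigidityStrata
open Summit.NavierStokesRegularity.NavierStokesRegularity.Cruxes.ScarEnvelopeTypeI.AxisActivity
open Literature.ComputerArithmetic.BrentZimmermann2010.CommensurableBases

namespace Summit.NavierStokesRegularity.NavierStokesRegularity.Theorems.ScenarioCensus.HullMeter

variable {C : ℝ} {u : ℝ → E3 → E3}

/-! ## D. CONVERGENCE-MODE × SCALE-ARITHMETIC dial: zooms converging along an `F`-stable scale set kill the element -/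

/-- **MASTER THEOREM.** Let `F` be a set of positive factors with the past Liouville property at `C`, and `S ⊆ ℝ` an
unbounded scale set stable under multiplication by every `c ∈ F`.  If the zooms `u_s(t₀, x)` of `u ∈ A_C` converge
as `s → ∞` ALONG `S`, for each `x` in some nonempty open `U`, at ONE time `t₀ < 0` (to anything), then `u ≡ 0` on the
past.  Proof: extract a hull member `W` along scales in `S`; the `c`-multiples of those scales are again in `S`, and
their zooms converge both to `c`-zoomed `W` and to the same germ limit — so `W` is `F`-invariant on the germ, hence on
the whole past (`dss_of_germ`), hence `W ≡ 0` (past Liouville), hence `u ≡ 0` (one-limit Liouville). -/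
theorem eq_zero_of_zoomsConverge {F : Set ℝ} (hFpos : ∀ c ∈ F, 0 < c) (hF : PastLiouville C F)
    (hu : IsTypeIAncientMild C u) {S : Set ℝ} (hS : ∀ M : ℝ, ∃ s ∈ S, M ≤ s)
    (hSF : ∀ c ∈ F, ∀ s ∈ S, c * s ∈ S) {t₀ : ℝ} (ht₀ : t₀ < 0) {U : Set E3} (hU : IsOpen U)
    (hne : U.Nonempty) {w : E3 → E3}
    (hconv : ∀ x ∈ U, Tendsto (fun s : ℝ => nsRescale s u t₀ x) (atTop ⊓ 𝓟 S) (𝓝 (w x))) :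
    ∀ t < 0, ∀ x, u t x = 0 := by
  choose s hsS hsk using fun k : ℕ => hS ((k : ℝ) + 1)
  have hspos : ∀ k, 0 < s k := fun k => by
    have h1 := hsk k
    have h2 : (0 : ℝ) ≤ k := Nat.cast_nonneg k
    linarith
  have hslim : Tendsto s atTop atTop :=
    tendsto_atTop_mono (fun k => hsk k) (tendsto_natCast_atTop_atTop.atTop_add tendsto_const_nhds)
  obtain ⟨φ, hφ, W, hWh, hW, hpt, hloc⟩ := exists_hull_limit hu hspos hslim
  have hφlim : Tendsto (fun j => s (φ j)) atTop atTop := hslim.comp hφ.tendsto_atTop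
  have hwithin1 : Tendsto (fun j => s (φ j)) atTop (atTop ⊓ 𝓟 S) :=
    tendsto_inf.2 ⟨hφlim, tendsto_principal.2 (Eventually.of_forall fun j => hsS _)⟩
  have hwithin : ∀ c ∈ F, Tendsto (fun j => c * s (φ j)) atTop (atTop ⊓ 𝓟 S) := fun c hc =>
    tendsto_inf.2 ⟨hφlim.const_mul_atTop (hFpos c hc),
      tendsto_principal.2 (Eventually.of_forall fun j => hSF c hc _ (hsS _))⟩
  -- Step 1: on the germ, `W(t₀, ·)` is the germ limit
  have hWg : ∀ x ∈ U, W t₀ x = w x := fun x hx =>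
    tendsto_nhds_unique (hpt t₀ ht₀ x) ((hconv x hx).comp hwithin1)
  -- Step 2: on the germ, `W` is invariant under the zoom by every `c ∈ F`
  have hgerm : ∀ c ∈ F, ∀ x ∈ U, nsRescale c W t₀ x = W t₀ x := by
    intro c hc x hx
    have hct : c ^ 2 * t₀ < 0 := mul_neg_of_pos_of_neg (by positivity [hFpos c hc]) ht₀
    have hA : Tendsto (fun j => nsRescale (c * s (φ j)) u t₀ x) atTop (𝓝 (nsRescale c W t₀ x)) := by
      have h1 : Tendsto (fun j => c • nsRescale (s (φ j)) u (c ^ 2 * t₀) (c • x)) atTop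
          (𝓝 (c • W (c ^ 2 * t₀) (c • x))) := (hpt _ hct _).const_smul c
      show Tendsto (fun j => nsRescale (c * s (φ j)) u t₀ x) atTop (𝓝 (c • W (c ^ 2 * t₀) (c • x)))
      refine h1.congr fun j => ?_
      rw [mul_comm c, nsRescale_mul]
      rfl
    have hB : Tendsto (fun j => nsRescale (c * s (φ j)) u t₀ x) atTop (𝓝 (w x)) :=
      (hconv x hx).comp (hwithin c hc)
    rw [tendsto_nhds_unique hA hB, hWg x hx]
  -- Step 3: germ invariance propagates to the whole past (tree `dss_of_germ`)
  have hinv : PastInvariant F W := fun c hc t ht x =>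
    dss_of_germ hW (hFpos c hc) ht₀ hU hne (hgerm c hc) ht x
  -- Step 4: past Liouville, then one-limit Liouville
  exact eq_zero_of_zero_mem_hull hu hWh (hF W hW hinv)

/-- A strictly increasing scale sequence: convergence along the sequence is convergence along its range within `atTop`. -/
theorem inf_principal_range_le_map {f : ℕ → ℝ} (hf : StrictMono f) :
    (atTop ⊓ 𝓟 (range f) : Filter ℝ) ≤ map f atTop := by
  intro A hA
  rw [mem_map, mem_atTop_sets] at hA
  obtain ⟨N, hN⟩ := hA
  rw [mem_inf_principal, mem_atTop_sets]
  refine ⟨f N, fun b hb => ?_⟩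
  rintro ⟨k, rfl⟩
  exact hN k (hf.le_iff_le.1 hb)

/-- **ℕ-CONVERGENT BLOW-DOWN ⇒ 0.**  If the integer zooms `u_n(t₀, x)`, `n → ∞`, converge for each `x` in a nonempty open
set, at ONE time `t₀ < 0`, then `u ≡ 0` on the past.  (`ℕ` is ×2,×3-stable: unique factorisation + Kronecker.) -/
theorem eq_zero_of_zoomsConverge_nat (hu : IsTypeIAncientMild C u) {t₀ : ℝ} (ht₀ : t₀ < 0) {U : Set E3}
    (hU : IsOpen U) (hne : U.Nonempty) {w : E3 → E3}
    (hconv : ∀ x ∈ U, Tendsto (fun n : ℕ => nsRescale (n : ℝ) u t₀ x) atTop (𝓝 (w x))) :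
    ∀ t < 0, ∀ x, u t x = 0 := by
  have hF : ∀ c ∈ ({2, 3} : Set ℝ), 0 < c := by
    intro c hc
    simp only [mem_insert_iff, mem_singleton_iff] at hc
    rcases hc with rfl | rfl <;> norm_num
  refine eq_zero_of_zoomsConverge hF (pastLiouville_two_three C) hu
    (S := range (fun n : ℕ => (n : ℝ))) (fun M => ?_) ?_ ht₀ hU hne (w := w) fun x hx => ?_
  · obtain ⟨n, hn⟩ := exists_nat_ge M
    exact ⟨n, ⟨n, rfl⟩, hn⟩
  · rintro c hc _ ⟨n, rfl⟩
    simp only [mem_insert_iff, mem_singleton_iff] at hc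
    rcases hc with rfl | rfl
    · exact ⟨2 * n, by push_cast; rfl⟩
    · exact ⟨3 * n, by push_cast; rfl⟩
  · have h1 : Tendsto (fun s : ℝ => nsRescale s u t₀ x) (map (fun n : ℕ => (n : ℝ)) atTop) (𝓝 (w x)) :=
      tendsto_map'_iff.2 (hconv x hx)
    exact h1.mono_left (inf_principal_range_le_map Nat.strictMono_cast)

/-- **×2,×3-STABLE CONVERGENT BLOW-DOWN ⇒ 0** (along `{2ᵃ3ᵇ}`, or any ×2,×3-stable unbounded scale set). -/
theorem eq_zero_of_zoomsConverge_smooth (hu : IsTypeIAncientMild C u) {S : Set ℝ} (hS : ∀ M : ℝ, ∃ s ∈ S, M ≤ s)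
    (h2 : ∀ s ∈ S, 2 * s ∈ S) (h3 : ∀ s ∈ S, 3 * s ∈ S) {t₀ : ℝ} (ht₀ : t₀ < 0) {U : Set E3}
    (hU : IsOpen U) (hne : U.Nonempty) {w : E3 → E3}
    (hconv : ∀ x ∈ U, Tendsto (fun s : ℝ => nsRescale s u t₀ x) (atTop ⊓ 𝓟 S) (𝓝 (w x))) :
    ∀ t < 0, ∀ x, u t x = 0 := by
  have hF : ∀ c ∈ ({2, 3} : Set ℝ), 0 < c := by
    intro c hc
    simp only [mem_insert_iff, mem_singleton_iff] at hc
    rcases hc with rfl | rfl <;> norm_num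
  refine eq_zero_of_zoomsConverge hF (pastLiouville_two_three C) hu hS ?_ ht₀ hU hne hconv
  intro c hc s hs
  simp only [mem_insert_iff, mem_singleton_iff] at hc
  rcases hc with rfl | rfl
  · exact h2 s hs
  · exact h3 s hs

/-- **FULLY CONVERGENT («asymptotically self-similar») BLOW-DOWN ⇒ 0.**  If `u_μ(t₀, x)` converges as `μ → ∞` through
ALL real scales, for `x` in a nonempty open set, at one time `t₀ < 0`, then `u ≡ 0` on the past. -/
theorem eq_zero_of_zoomsConverge_real (hu : IsTypeIAncientMild C u) {t₀ : ℝ} (ht₀ : t₀ < 0) {U : Set E3}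
    (hU : IsOpen U) (hne : U.Nonempty) {w : E3 → E3}
    (hconv : ∀ x ∈ U, Tendsto (fun s : ℝ => nsRescale s u t₀ x) atTop (𝓝 (w x))) :
    ∀ t < 0, ∀ x, u t x = 0 :=
  eq_zero_of_zoomsConverge_smooth hu (S := univ) (fun M => ⟨M, mem_univ _, le_rfl⟩)
    (fun _ _ => mem_univ _) (fun _ _ => mem_univ _) ht₀ hU hne
    (fun x hx => by rw [principal_univ, inf_top_eq]; exact hconv x hx)

/-- **FINE-LACUNARY CONVERGENT BLOW-DOWN ⇒ 0.**  There is `c₁ = c₁(C) > 1` such that: if for some `1 < λ₀ < c₁` the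
lacunary zooms `u_{λ₀ᵏ}(t₀, x)`, `k → ∞`, converge for `x` in a nonempty open set, at one `t₀ < 0`, then `u ≡ 0`. -/
theorem eq_zero_of_zoomsConverge_fineLacunary (C : ℝ) :
    ∃ c₁ : ℝ, 1 < c₁ ∧ ∀ lam : ℝ, 1 < lam → lam < c₁ → ∀ u : ℝ → E3 → E3, IsTypeIAncientMild C u →
      ∀ t₀ < (0 : ℝ), ∀ U : Set E3, IsOpen U → U.Nonempty → ∀ w : E3 → E3,
        (∀ x ∈ U, Tendsto (fun k : ℕ => nsRescale (lam ^ k) u t₀ x) atTop (𝓝 (w x))) →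
        ∀ t < 0, ∀ x, u t x = 0 := by
  obtain ⟨c₁, hc₁, H⟩ := pastLiouville_nearOne C
  refine ⟨c₁, hc₁, fun lam h1 h2 u hu t₀ ht₀ U hU hne w hconv => ?_⟩
  have hlam : 0 < lam := one_pos.trans h1
  have hmono : StrictMono (fun k : ℕ => lam ^ k) :=
    strictMono_nat_of_lt_succ fun k => by
      show lam ^ k < lam ^ (k + 1)
      rw [pow_succ]; exact lt_mul_of_one_lt_right (pow_pos hlam k) h1
  refine eq_zero_of_zoomsConverge (F := {lam}) (by simpa using hlam) (H lam h1 h2) hu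
    (S := range (fun k : ℕ => lam ^ k)) (fun M => ?_) ?_ ht₀ hU hne (w := w) fun x hx => ?_
  · obtain ⟨k, hk⟩ := pow_unbounded_of_one_lt M h1
    exact ⟨lam ^ k, ⟨k, rfl⟩, hk.le⟩
  · rintro c hc _ ⟨k, rfl⟩
    rw [mem_singleton_iff] at hc
    subst hc
    exact ⟨k + 1, by show c ^ (k + 1) = c * c ^ k; rw [pow_succ, mul_comm]⟩
  · have h1 : Tendsto (fun s : ℝ => nsRescale s u t₀ x) (map (fun k : ℕ => lam ^ k) atTop) (𝓝 (w x)) :=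
      tendsto_map'_iff.2 (hconv x hx)
    exact h1.mono_left (inf_principal_range_le_map hmono)

/-! ## E. ZOOM-DEFECT SPECTRUM: the universal gap (the quantitative N1 datum) -/

/-- **UNIVERSAL GAP from a past Liouville theorem.**  If `F` (positive factors) has the past Liouville property at `C`,
there is `δ = δ(C, F) > 0` such that EVERY `u ∈ A_C` with `u ≢ 0` on the past has, at ALL sufficiently large scales
`μ`, a factor `c ∈ F` and a point `x ∈ B₁` with `‖u_{cμ}(−1, x) − u_μ(−1, x)‖ > δ`.  Proof: otherwise normalise a bad
sequence, extract (KNSS), get a limit that is `F`-invariant on the germ `B₁ × {−1}`, hence on the past, hence zero —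
contradicting the S3 loudness the normalised fields carry on `B̄_K × {−1}`. -/
theorem universal_gap {F : Set ℝ} (hFpos : ∀ c ∈ F, 0 < c) (hF : PastLiouville C F) :
    ∃ δ : ℝ, 0 < δ ∧ ∀ u : ℝ → E3 → E3, IsTypeIAncientMild C u → (∃ t < (0 : ℝ), ∃ x, u t x ≠ 0) →
      ∃ μ₁ : ℝ, 0 < μ₁ ∧ ∀ μ : ℝ, μ₁ ≤ μ →
        ∃ c ∈ F, ∃ x : E3, ‖x‖ < 1 ∧ δ < ‖nsRescale (c * μ) u (-1) x - nsRescale μ u (-1) x‖ := by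
  by_contra H
  push Not at H
  obtain ⟨ε, hε, K, hK, hsub⟩ := substantial_at_large_scales C
  have hδn : ∀ n : ℕ, (0 : ℝ) < 1 / ((n : ℝ) + 1) := fun n => by positivity
  choose v hv hvne hvsmall using fun n : ℕ => H _ (hδn n)
  choose μ₁ hμ₁ hloud using fun n => hsub (v n) (hv n) (hvne n)
  choose μ hμge hsmall using fun n => hvsmall n (μ₁ n) (hμ₁ n)
  have hμpos : ∀ n, 0 < μ n := fun n => (hμ₁ n).trans_le (hμge n)
  have hw : ∀ n, IsTypeIAncientMild C (nsRescale (μ n) (v n)) := fun n => zoom_isTypeIAncientMild (hv n) (hμpos n)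
  obtain ⟨φ, hφ, W, hW, hpt, -, hloc, -⟩ := exists_tendsto_of_isTypeIAncientMild_seq C hw
  -- (i) the limit is `F`-invariant on the germ `B₁ × {−1}`
  have hgerm : ∀ c ∈ F, ∀ x ∈ ball (0 : E3) 1, nsRescale c W (-1) x = W (-1) x := by
    intro c hc x hx
    rw [mem_ball_zero_iff] at hx
    have hcpos : 0 < c := hFpos c hc
    have hct : c ^ 2 * (-1 : ℝ) < 0 := mul_neg_of_pos_of_neg (by positivity) (by norm_num)
    have hA : Tendsto (fun j => nsRescale c (nsRescale (μ (φ j)) (v (φ j))) (-1) x) atTop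
        (𝓝 (nsRescale c W (-1) x)) := by
      show Tendsto (fun j => c • nsRescale (μ (φ j)) (v (φ j)) (c ^ 2 * (-1)) (c • x)) atTop
        (𝓝 (c • W (c ^ 2 * (-1)) (c • x)))
      exact (hpt _ hct _).const_smul c
    have hB : Tendsto (fun j => nsRescale (μ (φ j)) (v (φ j)) (-1) x) atTop (𝓝 (W (-1) x)) :=
      hpt _ (by norm_num) _
    have hdiff := (hA.sub hB).norm
    have hbound : Tendsto (fun j : ℕ => 1 / ((φ j : ℝ) + 1)) atTop (𝓝 0) :=
      tendsto_const_nhds.div_atTop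
        ((tendsto_natCast_atTop_atTop.comp hφ.tendsto_atTop).atTop_add tendsto_const_nhds)
    have hle : ‖nsRescale c W (-1) x - W (-1) x‖ ≤ 0 := by
      refine le_of_tendsto_of_tendsto' hdiff hbound fun j => ?_
      have h := hsmall (φ j) c hc x hx
      rwa [mul_comm, nsRescale_mul] at h
    exact sub_eq_zero.1 (norm_le_zero_iff.1 hle)
  -- (ii) hence on the whole past, and the limit vanishes there
  have hinv : PastInvariant F W := fun c hc t ht x =>
    dss_of_germ hW (hFpos c hc) (by norm_num : (-1 : ℝ) < 0) isOpen_ball ⟨0, mem_ball_self one_pos⟩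
      (hgerm c hc) ht x
  have hW0 : ∀ t < 0, ∀ x, W t x = 0 := hF W hW hinv
  -- (iii) but the normalised fields are uniformly loud on `B̄_K × {−1}`
  have hK' : IsCompact (closedBall (0 : E3) K) := isCompact_closedBall _ _
  have hunif : TendstoUniformlyOn (fun j => nsRescale (μ (φ j)) (v (φ j)) (-1)) (W (-1)) atTop
      (closedBall (0 : E3) K) :=
    (tendstoLocallyUniformlyOn_iff_tendstoUniformlyOn_of_compact hK').1
      (hloc (-1) (by norm_num)).tendstoLocallyUniformlyOn
  obtain ⟨j, hj⟩ := ((Metric.tendstoUniformlyOn_iff.1 hunif) ε hε).exists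
  obtain ⟨y, hyK, hbig⟩ := hloud (φ j) (μ (φ j)) (hμge (φ j))
  have hyj : y ∈ closedBall (0 : E3) K := by rw [mem_closedBall, dist_zero_right]; exact hyK
  have h1 := hj y hyj
  rw [hW0 (-1) (by norm_num) y, dist_zero_left] at h1
  exact absurd h1 (not_lt.2 hbig.le)

/-- **THE UNIVERSAL {2,3}-GAP** (every `C`): `∃ δ = δ(C) > 0`, every non-trivial `u ∈ A_C` differs, at all large scales `μ`,
from its zoom by `2` OR by `3` by more than `δ` somewhere on `B₁ × {−1}`. -/
theorem universal_gap_two_three (C : ℝ) :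
    ∃ δ : ℝ, 0 < δ ∧ ∀ u : ℝ → E3 → E3, IsTypeIAncientMild C u → (∃ t < (0 : ℝ), ∃ x, u t x ≠ 0) →
      ∃ μ₁ : ℝ, 0 < μ₁ ∧ ∀ μ : ℝ, μ₁ ≤ μ →
        ∃ c ∈ ({2, 3} : Set ℝ), ∃ x : E3, ‖x‖ < 1 ∧ δ < ‖nsRescale (c * μ) u (-1) x - nsRescale μ u (-1) x‖ :=
  universal_gap (by
    intro c hc
    simp only [mem_insert_iff, mem_singleton_iff] at hc
    rcases hc with rfl | rfl <;> norm_num) (pastLiouville_two_three C)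

/-- **THE UNIVERSAL NEAR-ONE GAP**: for `1 < λ₀ < c₁(C)` a single factor suffices. -/
theorem universal_gap_nearOne (C : ℝ) :
    ∃ c₁ : ℝ, 1 < c₁ ∧ ∀ lam : ℝ, 1 < lam → lam < c₁ →
      ∃ δ : ℝ, 0 < δ ∧ ∀ u : ℝ → E3 → E3, IsTypeIAncientMild C u → (∃ t < (0 : ℝ), ∃ x, u t x ≠ 0) →
        ∃ μ₁ : ℝ, 0 < μ₁ ∧ ∀ μ : ℝ, μ₁ ≤ μ →
          ∃ x : E3, ‖x‖ < 1 ∧ δ < ‖nsRescale (lam * μ) u (-1) x - nsRescale μ u (-1) x‖ := by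
  obtain ⟨c₁, hc₁, H⟩ := pastLiouville_nearOne C
  refine ⟨c₁, hc₁, fun lam h1 h2 => ?_⟩
  obtain ⟨δ, hδ, G⟩ := universal_gap (F := {lam}) (by simpa using one_pos.trans h1) (H lam h1 h2)
  refine ⟨δ, hδ, fun u hu hne => ?_⟩
  obtain ⟨μ₁, hμ₁, G1⟩ := G u hu hne
  refine ⟨μ₁, hμ₁, fun μ hμ => ?_⟩
  obtain ⟨c, hc, x, hx, hgap⟩ := G1 μ hμ
  rw [mem_singleton_iff] at hc
  subst hc
  exact ⟨x, hx, hgap⟩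

/-! ## F. CARDINALITY dial: a countable past-hull forces triviality -/

/-- The hull is invariant under every zoom. -/
theorem nsRescale_mem_hull {W : ℝ → E3 → E3} (hW : W ∈ hull C u) {c : ℝ} (hc : 0 < c) :
    nsRescale c W ∈ hull C u := by
  obtain ⟨hWc, μ, hμpos, hμlim, hconv⟩ := mem_hull.1 hW
  refine mem_hull.2 ⟨zoom_isTypeIAncientMild hWc hc, fun k => μ k * c, fun k => mul_pos (hμpos k) hc,
    hμlim.atTop_mul_const hc, fun t ht => ?_⟩
  have hct : c ^ 2 * t < 0 := mul_neg_of_pos_of_neg (by positivity) ht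
  have h1 : TendstoLocallyUniformly (fun k => fun x : E3 => nsRescale (μ k) u (c ^ 2 * t) (c • x))
      (fun x : E3 => W (c ^ 2 * t) (c • x)) atTop :=
    (hconv _ hct).comp (fun x : E3 => c • x) (continuous_const_smul c)
  have h2 := (uniformContinuous_const_smul c).comp_tendstoLocallyUniformly h1
  have e : (fun k => nsRescale (μ k * c) u t) =
      fun k => (fun v : E3 => c • v) ∘ fun x : E3 => nsRescale (μ k) u (c ^ 2 * t) (c • x) := by
    funext k
    rw [nsRescale_mul]
    rfl
  show TendstoLocallyUniformly (fun k => nsRescale (μ k * c) u t) (nsRescale c W t) atTop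
  rw [e]
  exact h2

/-- A continuous real function with countable range is constant (intermediate values fill a continuum). -/
theorem apply_eq_of_countable_range {f : ℝ → ℝ} (hf : Continuous f) (hc : (range f).Countable) (a b : ℝ) :
    f a = f b := by
  have hord : OrdConnected (range f) := isPreconnected_iff_ordConnected.1 (isPreconnected_range hf)
  by_contra hne
  rcases lt_or_gt_of_ne hne with h | h
  · have hcount : (Icc (f a) (f b)).Countable :=
      hc.mono (hord.out (mem_range_self a) (mem_range_self b))
    have h' := hcount.le_aleph0
    rw [Cardinal.mk_Icc_real h] at h'
    exact absurd h' (not_le.2 Cardinal.aleph0_lt_continuum)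
  · have hcount : (Icc (f b) (f a)).Countable :=
      hc.mono (hord.out (mem_range_self b) (mem_range_self a))
    have h' := hcount.le_aleph0
    rw [Cardinal.mk_Icc_real h] at h'
    exact absurd h' (not_le.2 Cardinal.aleph0_lt_continuum)

/-- **COUNTABLE PAST-HULL ⇒ 0.**  If the blow-down hull of `u ∈ A_C`, counted modulo the past, is countable, then
`u ≡ 0` on the past: the scaling orbit `σ ↦ e^σ-zoom of W` of a hull member `W` lies in the hull; paired with any test
vector at any past point it is a continuous real function of `σ` with countable range, hence constant; so `W` is
scale-invariant on the past, hence zero (backward self-similar Liouville, tree `eq_zero_of_scaleInvariant`), and one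
vanishing hull member kills `u`. -/
theorem eq_zero_of_countable_pastHull (hu : IsTypeIAncientMild C u) (hcount : (pastHull C u).Countable) :
    ∀ t < 0, ∀ x, u t x = 0 := by
  obtain ⟨W, hWh⟩ := hull_nonempty hu
  have hW : IsTypeIAncientMild C W := (mem_hull.1 hWh).1
  have hsc : ∀ lam : ℝ, 0 < lam → ∀ s < (0 : ℝ), ∀ y : E3, lam • W (lam ^ 2 * s) (lam • y) = W s y := by
    intro lam hlam s hs y
    have key : ∀ e : E3, inner ℝ (lam • W (lam ^ 2 * s) (lam • y)) e = inner ℝ (W s y) e := by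
      intro e
      have hfc : Continuous fun σ : ℝ => inner ℝ (Real.exp σ • W (Real.exp σ ^ 2 * s) (Real.exp σ • y)) e :=
        (continuous_orbit hW.continuousOn_uncurry hs y).inner continuous_const
      have hrange : (range fun σ : ℝ =>
          inner ℝ (Real.exp σ • W (Real.exp σ ^ 2 * s) (Real.exp σ • y)) e).Countable := by
        refine (hcount.image fun V : ℝ → E3 → E3 => inner ℝ (V s y) e).mono ?_
        rintro _ ⟨σ, rfl⟩
        refine ⟨pastPart (nsRescale (Real.exp σ) W),
          ⟨nsRescale (Real.exp σ) W, nsRescale_mem_hull hWh (Real.exp_pos σ), rfl⟩, ?_⟩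
        show inner ℝ (pastPart (nsRescale (Real.exp σ) W) s y) e =
          inner ℝ (Real.exp σ • W (Real.exp σ ^ 2 * s) (Real.exp σ • y)) e
        rw [pastPart_of_neg hs, nsRescale_apply]
      have h := apply_eq_of_countable_range hfc hrange (Real.log lam) 0
      simp only [Real.exp_log hlam, Real.exp_zero, one_pow, one_mul, one_smul] at h
      exact h
    exact ext_inner_right ℝ key
  have hW0 : ∀ t < 0, ∀ x, W t x = 0 :=
    eq_zero_of_scaleInvariant hW.hasTypeITimeDecay hW.continuousOn_uncurry
      (fun s t hst ht x => hW.mild_eq_heatExtension hst ht x) (fun t ht => hW.isDivFree ht) hsc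
  exact eq_zero_of_zero_mem_hull hu hWh hW0

end Summit.NavierStokesRegularity.NavierStokesRegularity.Theorems.ScenarioCensus.HullMeter

end
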